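import Summits.AtomisticToContinuum.FouriersLaw.Theorems.OddSectorIrreversibilitySubBallisticWindowPartial
import Literature.MathematicalPhysics.KineticTheory.PhaseSpacePoisson

/-!
# Line `Sketch` (coboundary–Thomson ceiling) — skeleton v6 for crux `SubBallisticWindow` (E2): 5/6 stubs + partial results + reduction LANDED, 1 stub open

Crux item `stmt-AtomisticToContinuum-14070`, route `OddSectorIrreversibility` (rank 3):
`∀ ω₂ lam β γ > 0 ∀ T > 0 ∃ C ∀ N, k₁ ≤ k₂, k₂ + 1 ≤ N, τ ≥ 0:
 ∫ (∫_{(0,τ]} (P⁰_t J_B)(x) dt)² e^{-H(x)/T} dx ≤ C (1+τ) (k₂−k₁) Z`,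
`J_B = Σ_{k₁ ≤ i < k₂} j_i`, `P⁰_t` the transition kernels of the CLOSED chain `pinnedChain ω₂ lam β 0`
(Dirac masses at the Hamiltonian flow `Φ_t = detFlow`, `ZeroFrictionDictionary.transitionKernel_zero_friction`),
`Z = ∫ e^{-H/T}`.

## The line (idea card `Cruxes/SubBallisticWindow/Ideas/coboundary-thomson-ceiling.md`, ideator 1; the
## evidence sketch `Sketch.lean` is rebuilt here in `stub_*` form, stubs in the crux's raw vocabulary)

Notation: `μ = e^{-H/T} dq dp` (the crux's `μT`), `Z` its mass, `J_B` the block current (the crux's `JB`),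
`Q_B(τ)(x) = ∫_{(0,τ]} J_B(Φ_t x) dt` (`Φ_t = detFlow ω₂ lam β N t`), `{H,·} = poisson H`, `ℓ = k₂ − k₁`,
`V_B(τ) = ∫ Q_B(τ)² dμ`.

  V_B(τ) ≤ 8 ∫(G−c)² dμ + 2τ² ∫(J_B − {H,G})² dμ   ∀ G ∈ C², c      (stub_coboundaryCeiling, FIXED N, size M:
                                                                     Q_B = (G∘Φ_τ − G) + ∫₀^τ (J_B − {H,G})∘Φ_t,
                                                                     Liouville invariance of μ — LANDED,
                                                                     `ClosedChainFlow.measurePreserving_closedChainFlow_gibbsWeight`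
                                                                     — FTC along the flow, (a+b)² ≤ 2a²+2b², Jensen in t)
  Var_μ(G) ≤ (T/min(ω₂,1)) ∫ ‖∇G‖² dμ               ∀ G ∈ C¹       (stub_gibbsPoincare, N-UNIFORM statics, size M:
                                                                     Brascamp–Lieb / Bakry–Émery for the uniformly convex
                                                                     `H/T` (`U'' ≥ ω₂`, `V'' ≥ 1`, `∂²_p = 1`), transferred from
                                                                     the PROVED tree fact `BrascampLieb1976_thm41_uniform_holds`)
  ∫ q_i^{2m} dμ, ∫ p_i^{2m} dμ ≤ C_m Z                ∀ N, i         (stub_gibbsMoments, N-UNIFORM statics, size M, from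
                                                                     stub_gibbsPoincare by the recursion f = q_i^m and the
                                                                     reflection symmetries q ↦ −q, p ↦ −p of μ)
  ∫ J_B² dμ ≤ C_J ℓ Z                                 ∀ N, B         (stub_staticCurrentBound, N-UNIFORM statics, size M:
                                                                     ⟨j_i j_{i'}⟩ = 0 for |i − i'| ≥ 2 by Gaussian integration by
                                                                     parts in p, Cauchy–Schwarz for neighbours, moments)
  ∃ G, c: 8∫(G−c)² + 2τ²∫(J_B − {H,G})² ≤ C_Eℓ²(ℓ+τ)Z ∀ N, B, τ ≥ 1  (stub_rampCorrector, N-UNIFORM statics, size L: the RETURN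
                                                                     RAMP G = Σ_k w_k h_k (`Negative.ClosedFlow.weightedEnergy`),
                                                                     Var ≤ C_W Σw_k² Z by Poincaré + moments, defect (ℓ/M)J_ret by
                                                                     the static current bound; = E2 for bounded blocks incl. the
                                                                     single bond ℓ = 1, uniformly in N; the harmonic truth)
  ∃ G, c: 8∫(G−c)² + 2τ²∫(J_B − {H,G})² ≤ C_F(1+τ)ℓZ   ∀ N, ℓ ≥ 2, τ ≥ 1 (stub_correctorFamily, N-UNIFORM, HARDEST — the lead's:
                                                                     "beat the energy ramp by a factor ℓ"; E2-equivalent by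
                                                                     the Abel corrector, TRIAGE-r1-1 App. C3)
  ⟹ E2 with C = 2·max(C_J,0) + max(C_E,0) + max(C_F,0):  τ ≤ 1: G = 0 and the static current bound
  (τ² ≤ 1+τ);  τ ≥ 1, ℓ ≤ 1: the ramp corrector (ℓ²(ℓ+τ) ≤ ℓ(1+τ));  τ ≥ 1, ℓ ≥ 2: the corrector family.

## Status (lead continuation, 2026-08-16, skeleton v6)
v6: the composition itself is now the TREE theorem `…SubBallisticWindow.Partial.subBallisticWindow_of_correctorFamily`
(p96070, file `Theorems/OddSectorIrreversibilitySubBallisticWindowPartial.lean`, which also lands the unconditional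
N-uniform consequences `ballisticEnvelope` `V_B ≤ Cℓ²(ℓ+τ)Z`, `shortWindows` (E2, τ ≤ 1), `boundedBlocks` (E2, ℓ ≤ ℓ₀),
`singleBond`); `SubBallisticWindow_of` below is that theorem applied to the one open stub.
Five of the six stubs of v3 are LANDED tree theorems (used inside the Partial file's composition):
`…Theorems.SubBallisticWindow.CoboundaryCeiling.stub_coboundaryCeiling` (p88261),
`…GibbsPoincare.stub_gibbsPoincare` (p88298), `…GibbsMoments.stub_gibbsMoments` (p87442),
`…StaticCurrentBound.stub_staticCurrentBound` (p88552), `…RampCorrector.stub_rampCorrector` (p88551).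
The ONE registered stub left is `stub_correctorFamily` (E2 on `ℓ ≥ 2`, `τ ≥ 1` in Thomson form; E2-equivalent).

## Mechanics
* Registered stubs (v3) = the six `theorem stub_…`; in v5 only `stub_correctorFamily := by sorry` remains; their signatures are self-contained over
  TREE declarations (`pinnedChain`, `OscillatorChain.hamiltonian/bondCurrent/transitionKernel`, `poisson`,
  `partialQ/partialP`, `ZeroFrictionDictionary.detFlow`, Mathlib) in the crux's own `let`-vocabulary, so a
  landed `--supports` proof restates them verbatim. `sorry` occurs nowhere else.
* `SubBallisticWindow_of : SubBallisticWindow` concludes the crux decl BY NAME; its body (v3–v5: the complete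
  composition — Dirac dictionary `integral_transitionKernel_zero_friction`, case split at `τ = 1` and `ℓ = 1` — now
  landed as `Partial.subBallisticWindow_of_correctorFamily`) applies that tree theorem to `stub_correctorFamily`.
* Disproof.lean (cdisprove cycle 1) honoured: §1 no junk (the Dirac dictionary is the first step of the glue);
  §3 the fixed-`N` theorem is NOT a stub (every N-uniform stub quantifies `∃ C ∀ N`); §4 `0 < γ` decoration —
  `γ` enters only through the `γ`-free density; `0 < lam, 0 < β` are hypotheses of the hard stub only (the
  statics and the coboundary ceiling hold for `lam, β ≥ 0` — consistent with the harmonic calibration: at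
  `lam = β = 0` no corrector beats the ramp, Barriers `HarmonicChainBallisticFlux`). `-- Targets`: none yet.
-/

noncomputable section

namespace Summit.AtomisticToContinuum.FouriersLaw.Cruxes.SubBallisticWindow.Coboundary

open MeasureTheory Filter Topology Set
open scoped NNReal ENNReal
open Literature.MathematicalPhysics.KineticTheory.HeatConduction
open Summit.AtomisticToContinuum.FouriersLaw.Theorems.ClosedConeSensitivity.Negative.ZeroFrictionDictionary
open Summit.AtomisticToContinuum.FouriersLaw.Theses.OddSectorIrreversibility

/-! ## The ONE remaining REGISTERED stub (`theorem stub_correctorFamily := by sorry`; `sorry` occurs nowhere else) -/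

/-- **stub_correctorFamily** (N-UNIFORM, HARDEST — the lead's stub; E2-equivalent for `ℓ ≥ 2`): for all
parameters `> 0` and `T > 0` there is `C_F` such that for every `N`, block `[k₁,k₂)` with `ℓ = k₂ − k₁ ≥ 2`
(`k₂ + 1 ≤ N`) and window `τ ≥ 1` SOME test observable `G ∈ C²` (with `G, {H,G} ∈ L²(μ)`) and constant `c`
achieve `8 ∫ (G − c)² dμ + 2 τ² ∫ (J_B − {H,G})² dμ ≤ C_F (1+τ) (k₂ − k₁) Z`.
"Beat the energy ramp by a factor `ℓ`": weighted site energies (`stub_rampCorrector`) give `ℓ²(ℓ+τ)` — the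
harmonic truth (`HarmonicChainBallisticFlux`); the factor `ℓ` needs a genuinely anharmonic (nonlinear)
corrector. Equivalent to E2 on `ℓ ≥ 2` (`⇐`: the Abel corrector `G = −∫₀^∞ e^{−t/τ} J_B∘Φ_t dt`,
TRIAGE-r1-1 App. C3). -/
theorem stub_correctorFamily :
    ∀ ω₂ lam β γ : ℝ, 0 < ω₂ → 0 < lam → 0 < β → 0 < γ → ∀ T : ℝ, 0 < T → ∃ C : ℝ,
      ∀ (N k₁ k₂ : ℕ), k₁ ≤ k₂ → k₁ + 2 ≤ k₂ → k₂ + 1 ≤ N → ∀ τ : ℝ, 1 ≤ τ →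
        ∃ (G : PhaseSpace N → ℝ) (c : ℝ), ContDiff ℝ 2 G ∧
          MemLp G 2 (volume.withDensity fun x : PhaseSpace N => ENNReal.ofReal (Real.exp (-((pinnedChain ω₂ lam β γ).hamiltonian N x) / T))) ∧
          MemLp (poisson ((pinnedChain ω₂ lam β γ).hamiltonian N) G) 2
            (volume.withDensity fun x : PhaseSpace N => ENNReal.ofReal (Real.exp (-((pinnedChain ω₂ lam β γ).hamiltonian N x) / T))) ∧
          8 * ∫ x, (G x - c) ^ 2
              ∂(volume.withDensity fun x : PhaseSpace N => ENNReal.ofReal (Real.exp (-((pinnedChain ω₂ lam β γ).hamiltonian N x) / T))) +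
            2 * τ ^ 2 * ∫ x,
              ((fun z : PhaseSpace N => ∑ i : Fin N, (if k₁ ≤ i.val ∧ i.val < k₂ then (pinnedChain ω₂ lam β γ).bondCurrent N i z else 0)) x
                - poisson ((pinnedChain ω₂ lam β γ).hamiltonian N) G x) ^ 2
              ∂(volume.withDensity fun x : PhaseSpace N => ENNReal.ofReal (Real.exp (-((pinnedChain ω₂ lam β γ).hamiltonian N x) / T))) ≤
            C * (1 + τ) * ((k₂ : ℝ) - k₁) * (∫ x : PhaseSpace N, Real.exp (-((pinnedChain ω₂ lam β γ).hamiltonian N x) / T)) := by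
  sorry

/-! ## Proved glue (no `sorry` below this line) -/

/-- **Composition (v6).** The crux from the one remaining stub: the tree theorem
`SubBallisticWindow.Partial.subBallisticWindow_of_correctorFamily` (p96070) IS the composition of v3–v5
(Dirac dictionary; `τ ≤ 1`: `G = 0` + static current bound; `τ ≥ 1, ℓ ≤ 1`: return ramp; `τ ≥ 1, ℓ ≥ 2`: the
corrector family), with the five landed stubs inside it and `stub_correctorFamily` as its only hypothesis. [folklore] -/
theorem SubBallisticWindow_of : SubBallisticWindow :=
  _root_.Summit.AtomisticToContinuum.FouriersLaw.Theorems.SubBallisticWindow.Partial.subBallisticWindow_of_correctorFamily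
    stub_correctorFamily

end Summit.AtomisticToContinuum.FouriersLaw.Cruxes.SubBallisticWindow.Coboundary

end
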